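import Literature.NumberTheory.QuadraticFields.QuadraticDedekindZetaKronecker
import Literature.NumberTheory.QuadraticFields.KroneckerCharacterFourProofs
import Literature.NumberTheory.LFunctions.DedekindZetaThetaProofs
import Literature.NumberTheory.LFunctions.DirichletLFunctionZeroFreeRegion
import Literature.NumberTheory.LFunctions.LandauPageRealZeros
import Literature.NumberTheory.LFunctions.SiegelExceptionalZeroBound
import Literature.NumberTheory.LFunctions.ZetaZeroFreeRegion
import Literature.NumberTheory.LFunctions.ZetaLogDerivDisc
import Literature.NumberTheory.LFunctions.ZetaRealAxis
import HarnessLib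

/-!
# Zeros of the Dedekind zeta function of a quadratic field, uniformly in the discriminant

Topic `NumberTheory/QuadraticFields`, namespace `Literature.NumberTheory.QuadraticFields.Quadratic`
(continuing `QuadraticDedekindZetaKronecker.lean`: `ζ_K(s) = ζ(s) L(s, κ)` on `Re s > 1` for a
Dirichlet character `κ` with the Kronecker values). Everything here is PROVED (theorems only).

For a quadratic field `K` (`[K : ℚ] = 2`, any discriminant) we record:

* `exists_kroneckerChar` — there IS a Dirichlet character `κ ≠ 1` modulo `|d_K|` with
  `ζ_K(s) = ζ(s) L(s, κ)` for `Re s > 1` (odd `d_K`: the Jacobi character `(· / |d_K|)` of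
  `QuadraticDedekindZeta.lean`; even `d_K = 4m`: the Kronecker character mod `4|m|` of
  `KroneckerCharacterFourProofs.lean`, primitive, with `κ(p) = (m/p) = (d_K/p)` and `κ(2) = 0`);
* `dedekindZetaCont_eq_riemannZeta_mul_LFunction` — **`ζ_K(s) = ζ(s) L(s, κ)` on all of `ℂ ∖ {1}`**
  for the continued `ζ_K` (`dedekindZetaCont`, Hecke) and Mathlib's `L(s, κ)`: both sides are
  continuations of the Dirichlet series, and the continuation is unique
  (`IsDedekindZetaContinuation.unique`);
* consequences for the zeros, with ABSOLUTE constants (uniform in `K`), from the tree's theory of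
  `ζ` and of Dirichlet `L`-functions: `exists_zeroFree_dedekindZetaCont` — the zero-free region
  `σ > 1 − c/(log|d_K| + log(|t| + 4))` up to real zeros (de la Vallée-Poussin for `ζ`,
  Montgomery–Vaughan Theorem 11.3 for `L(s, κ)`); `exists_min_realZeros_dedekindZetaCont_le` — at
  most one real zero in `σ > 1 − c/(log|d_K| + log 4)` (MV Theorem 11.3 Case 4; `ζ(σ) < 0` on
  `(0, 1)`); `exists_one_sub_realZero_dedekindZetaCont_ge` — Siegel's bound `1 − β ≥ C(ε)|d_K|^{−ε}`
  for the real zeros (MV Corollary 11.15; ineffective).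

These are the `χ = 1` companions of the uniform results for the class group `L`-functions
`L(s, χ)`, `χ ≠ 1` (`LFunctions/ClassGroupLFunctionZeroFreeRegion.lean`,
`ClassGroupLFunctionRealZeros.lean`), as needed for prime number theorems in ideal classes of
imaginary quadratic fields uniform in the discriminant ([ThornerZaman2019, Theorem 3.1 with
`χ` trivial]).

## References

* H. L. Montgomery, R. C. Vaughan, *Multiplicative Number Theory I*, CUP 2007, §10.1 Ex. 26,
  Theorem 6.6, Theorem 11.3, Corollary 11.15. [MontgomeryVaughan2007]
* J. Neukirch, *Algebraic Number Theory*, Springer 1999, VII (5.10)–(5.12). [NeukirchANT1999]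
* J. Thorner, A. Zaman, *A unified and improved Chebotarev density theorem*, ANT 13 (2019),
  Theorem 3.1. [ThornerZaman2019]
-/

noncomputable section

open Module NumberField Complex Set
open scoped NumberTheorySymbols

namespace Literature.NumberTheory.QuadraticFields.Quadratic

open Literature.NumberTheory.LFunctions

variable {K : Type*} [Field K] [NumberField K]

/-! ### A Kronecker character for every quadratic field -/

/-- **The Kronecker character of a quadratic field**: for `[K : ℚ] = 2` there is a Dirichlet
character `κ ≠ 1` modulo `|d_K|` with `ζ_K(s) = ζ(s) L(s, κ)` for `Re s > 1` (stated with the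
modulus `M = |d_K|` as a separate natural number). Odd `d_K`: `κ = (· / |d_K|)`; even `d_K = 4m`
(`m ≡ 2, 3 (mod 4)` square-free): the character mod `4|m| = |d_K|` with `κ(n) = (m / n)` for odd `n`.
[cite: MontgomeryVaughan2007, §10.1 Exercise 26] -/
theorem exists_kroneckerChar (h2 : finrank ℚ K = 2) :
    ∃ (M : ℕ) (_ : NeZero M) (κ : DirichletCharacter ℂ M), M = (NumberField.discr K).natAbs ∧ κ ≠ 1 ∧
      κ ^ 2 = 1 ∧
      ∀ s : ℂ, 1 < s.re → NumberField.dedekindZeta K s = riemannZeta s * LSeries (fun n ↦ κ n) s := by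
  rcases isFundamentalDiscriminant_discr (K := K) h2 with ⟨h1, -, -⟩ | ⟨h4, hm4, hsq⟩
  · -- odd discriminant
    have hodd : Odd (NumberField.discr K) := by
      rw [Int.odd_iff]; omega
    haveI := neZero_natAbs_discr (K := K)
    exact ⟨(NumberField.discr K).natAbs, inferInstance, jacobiChar (NumberField.discr K).natAbs, rfl,
      jacobiChar_natAbs_discr_ne_one h2 hodd,
      MulChar.IsQuadratic.sq_eq_one (fun a ↦ jacobiChar_trichotomy a),
      fun s hs ↦ dedekindZeta_eq_riemannZeta_mul_LSeries h2 hodd hs⟩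
  · -- even discriminant `d = 4m`
    set m : ℤ := NumberField.discr K / 4 with hm
    have hm0 : m ≠ 0 := hsq.ne_zero
    have hdm : NumberField.discr K = 4 * m := by rw [hm, Int.mul_ediv_cancel' h4]
    haveI : NeZero (4 * m.natAbs) := ⟨mul_ne_zero (by norm_num) (Int.natAbs_ne_zero.mpr hm0)⟩
    obtain ⟨κ, hκ⟩ := exists_dirichletCharacter_four_mul m hm0
    have hprim : κ.IsPrimitive := isPrimitive_of_forall_odd hm4 hsq hκ
    have hM : 4 * m.natAbs = (NumberField.discr K).natAbs := by
      rw [hdm, Int.natAbs_mul]; rfl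
    have hne : κ ≠ 1 := by
      intro h
      have hc : κ.conductor = 4 * m.natAbs := hprim
      rw [h, DirichletCharacter.conductor_one] at hc
      have := Int.natAbs_pos.mpr hm0
      omega
    refine ⟨4 * m.natAbs, inferInstance, κ, hM, hne, (isQuadratic_of_forall_odd hm0 hκ).sq_eq_one,
      fun s hs ↦ ?_⟩
    refine dedekindZeta_eq_riemannZeta_mul_LSeries_of_kronecker h2 κ (fun p hp hp2 ↦ ?_) ?_ hs
    · -- odd primes: `κ(p) = (m/p) = (4m/p) = (d/p)`
      have hpodd : Odd p := hp.odd_of_ne_two hp2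
      rw [hκ p hpodd, hdm, jacobiSym.mul_left]
      have h4 : J(4 | p) = 1 := by
        rw [show (4 : ℤ) = 2 ^ 2 by norm_num]
        exact jacobiSym.sq_one' (by
          rw [show (2 : ℤ) = ((2 : ℕ) : ℤ) by rfl, Int.gcd_natCast_natCast]
          exact (Nat.coprime_primes Nat.prime_two hp).mpr (Ne.symm hp2))
      rw [h4, one_mul]
    · -- the prime `2`: `κ(2) = 0` and `d ≡ 0, 4 (mod 8)`
      have h81 : NumberField.discr K % 8 ≠ 1 := by omega
      have h85 : NumberField.discr K % 8 ≠ 5 := by omega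
      rw [if_neg h81, if_neg h85]
      refine apply_eq_zero_of_even (m := m) ?_
      have hlt : 2 < 4 * m.natAbs := by have := Int.natAbs_pos.mpr hm0; omega
      have : ((2 : ℕ) : ZMod (4 * m.natAbs)) = 2 := by norm_cast
      rw [← this, ZMod.val_natCast, Nat.mod_eq_of_lt hlt]
      exact even_two

/-! ### The factorisation of the continuation -/

/-- **`ζ_K(s) = ζ(s) L(s, κ)` for all `s ≠ 1`** (continued functions): if `κ ≠ 1` is a Dirichlet
character with `ζ_K(s) = ζ(s)L(s, κ)` on `Re s > 1`, then `s ↦ ζ(s)L(s, κ)` is a continuation of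
`ζ_K` off `s = 1` (`ζ` is holomorphic off `1`, `L(·, κ)` entire), hence equals `dedekindZetaCont K`
there by uniqueness of the continuation. [cite: NeukirchANT1999, Ch. VII (5.10)–(5.12)] -/
theorem dedekindZetaCont_eq_riemannZeta_mul_LFunction {M : ℕ} [NeZero M] {κ : DirichletCharacter ℂ M}
    (hκ : κ ≠ 1)
    (hfac : ∀ s : ℂ, 1 < s.re → NumberField.dedekindZeta K s = riemannZeta s * LSeries (fun n ↦ κ n) s)
    {s : ℂ} (hs : s ≠ 1) :
    dedekindZetaCont K s = riemannZeta s * κ.LFunction s := by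
  have hg : IsDedekindZetaContinuation K (fun z ↦ riemannZeta z * κ.LFunction z) := by
    refine ⟨fun z hz ↦ ?_, fun z hz ↦ ?_⟩
    · exact ((differentiableAt_riemannZeta hz).mul
        (DirichletCharacter.differentiable_LFunction hκ z)).differentiableWithinAt
    · have hz' : 1 < z.re := hz
      show riemannZeta z * κ.LFunction z = NumberField.dedekindZeta K z
      rw [hfac z hz', DirichletCharacter.LFunction_eq_LSeries κ hz']
  exact (Literature.NumberTheory.LFunctions.NumberField.isDedekindZetaContinuation_dedekindZetaCont_holds
    (K := K)).unique hg hs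

/-- The zeros of `ζ_K` off `s = 1` are the zeros of `ζ` and of `L(·, κ)`. [folklore] -/
theorem dedekindZetaCont_eq_zero_iff {M : ℕ} [NeZero M] {κ : DirichletCharacter ℂ M} (hκ : κ ≠ 1)
    (hfac : ∀ s : ℂ, 1 < s.re → NumberField.dedekindZeta K s = riemannZeta s * LSeries (fun n ↦ κ n) s)
    {s : ℂ} (hs : s ≠ 1) :
    dedekindZetaCont K s = 0 ↔ riemannZeta s = 0 ∨ κ.LFunction s = 0 := by
  rw [dedekindZetaCont_eq_riemannZeta_mul_LFunction hκ hfac hs, mul_eq_zero]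

/-! ### The zero-free region, uniformly in the discriminant -/

/-- **Zero-free region for `ζ_K`, `K` quadratic, uniformly in `d_K`**: there is an absolute `c > 0`
such that for every quadratic field `K` and every zero `ρ ≠ 1` of `ζ_K` with
`Re ρ > 1 − c/(log|d_K| + log(|Im ρ| + 4))`, `ρ` is real, `Re ρ < 1`, and `ρ` is a zero of
`L(s, κ)` for a quadratic Dirichlet character `κ ≠ 1` modulo `|d_K|` (de la Vallée-Poussin's region
for `ζ`, Montgomery–Vaughan Theorem 11.3 for `L(s, κ)`).
[cite: MontgomeryVaughan2007, Theorem 11.3] -/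
theorem exists_zeroFree_dedekindZetaCont :
    ∃ c : ℝ, 0 < c ∧ ∀ (K : Type) [Field K] [NumberField K], finrank ℚ K = 2 → ∀ ρ : ℂ, ρ ≠ 1 →
      dedekindZetaCont K ρ = 0 →
        1 - c / (Real.log ((NumberField.discr K).natAbs : ℝ) + Real.log (|ρ.im| + 4)) < ρ.re →
          ρ.im = 0 ∧ ρ.re < 1 ∧
            ∃ (M : ℕ) (_ : NeZero M) (κ : DirichletCharacter ℂ M), M = (NumberField.discr K).natAbs ∧
              κ ≠ 1 ∧ κ ^ 2 = 1 ∧ κ.LFunction ρ = 0 := by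
  obtain ⟨cζ, hcζ, hζ⟩ := classicalZFRData_riemannZeta.zeroFree
  obtain ⟨cD, hcD, hD⟩ := DirichletZFR.exists_zeroFree
  refine ⟨min (min cζ cD) (1 / 2), by positivity, fun K _ _ h2 ρ hρ1 hρ hregion ↦ ?_⟩
  have hc1 : min (min cζ cD) (1 / 2) ≤ cζ := (min_le_left _ _).trans (min_le_left _ _)
  have hc2 : min (min cζ cD) (1 / 2) ≤ cD := (min_le_left _ _).trans (min_le_right _ _)
  have hc3 : min (min cζ cD) (1 / 2) ≤ 1 / 2 := min_le_right _ _
  set c := min (min cζ cD) (1 / 2) with hcdef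
  obtain ⟨M, _, κ, hM, hκ, -, hfac⟩ := exists_kroneckerChar (K := K) h2
  have hlogd : 0 ≤ Real.log ((NumberField.discr K).natAbs : ℝ) := Real.log_natCast_nonneg _
  have hlogτ : 1 ≤ Real.log (|ρ.im| + 4) := ClassicalZFRData.one_le_log_tau ρ.im
  set ℒ : ℝ := Real.log ((NumberField.discr K).natAbs : ℝ) + Real.log (|ρ.im| + 4) with hℒ
  have hℒ1 : 1 ≤ ℒ := by linarith
  have hℒ0 : 0 < ℒ := by linarith
  have hcℒ : c / ℒ ≤ c := div_le_self (by positivity) hℒ1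
  rcases (dedekindZetaCont_eq_zero_iff hκ hfac hρ1).mp hρ with hz | hz
  · -- a zero of `ζ`: excluded by the classical region
    exfalso
    have hz₁ : riemannZeta₁ ρ = 0 := (riemannZeta₁_eq_zero_iff hρ1).mpr hz
    refine hζ ρ (by linarith) ?_ hz₁
    have h1 : c / ℒ ≤ cζ / Real.log (|ρ.im| + 4) := by
      calc c / ℒ ≤ c / Real.log (|ρ.im| + 4) :=
            div_le_div_of_nonneg_left (by positivity) (by linarith) (by linarith)
        _ ≤ cζ / Real.log (|ρ.im| + 4) := div_le_div_of_nonneg_right hc1 (by linarith)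
    linarith
  · -- a zero of `L(s, κ)`
    have hregion' : 1 - cD / (Real.log M + Real.log (|ρ.im| + 4)) < ρ.re := by
      have hM' : Real.log (M : ℝ) = Real.log ((NumberField.discr K).natAbs : ℝ) := by rw [hM]
      rw [hM']
      have : c / ℒ ≤ cD / ℒ := div_le_div_of_nonneg_right hc2 hℒ0.le
      linarith
    obtain ⟨hsq, him⟩ := hD M κ hκ ρ hz hregion'
    refine ⟨him, ?_, M, inferInstance, κ, hM, hκ, hsq, hz⟩
    by_contra hre
    exact DirichletCharacter.LFunction_ne_zero_of_one_le_re κ (Or.inl hκ) (not_lt.mp hre) hz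

/-! ### Real zeros -/

open scoped ComplexOrder in
/-- A real zero `β ∈ (0, 1)` of `ζ_K` is a zero of `L(s, κ)` (`ζ(β) < 0`). [folklore] -/
theorem LFunction_eq_zero_of_realZero {M : ℕ} [NeZero M] {κ : DirichletCharacter ℂ M} (hκ : κ ≠ 1)
    (hfac : ∀ s : ℂ, 1 < s.re → NumberField.dedekindZeta K s = riemannZeta s * LSeries (fun n ↦ κ n) s)
    {β : ℝ} (h0 : 0 < β) (h1 : β < 1) (hβ : dedekindZetaCont K β = 0) : κ.LFunction β = 0 := by
  have hβ1 : (β : ℂ) ≠ 1 := fun h ↦ by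
    have := congrArg Complex.re h; simp at this; linarith
  rcases (dedekindZetaCont_eq_zero_iff hκ hfac hβ1).mp hβ with hz | hz
  · exact absurd hz (riemannZeta_neg_of_pos_of_lt_one h0 h1).ne
  · exact hz

/-- **At most one real zero of `ζ_K` near `1`, uniformly in `d_K`** (`K` quadratic): there is an
absolute `c > 0` such that two distinct real zeros `β₀ ≠ β₁` of `ζ_K` in `(0, 1)` satisfy
`min(β₀, β₁) ≤ 1 − c/(log|d_K| + log 4)` (MV Theorem 11.3, Case 4, for `L(s, κ)`).
[cite: MontgomeryVaughan2007, Theorem 11.3 (proof, Case 4)] -/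
theorem exists_min_realZeros_dedekindZetaCont_le :
    ∃ c : ℝ, 0 < c ∧ ∀ (K : Type) [Field K] [NumberField K], finrank ℚ K = 2 → ∀ β₀ β₁ : ℝ,
      0 < β₀ → β₀ < 1 → 0 < β₁ → β₁ < 1 → β₀ ≠ β₁ →
        dedekindZetaCont K β₀ = 0 → dedekindZetaCont K β₁ = 0 →
          min β₀ β₁ ≤ 1 - c / (Real.log ((NumberField.discr K).natAbs : ℝ) + Real.log 4) := by
  obtain ⟨c, hc, h⟩ := DirichletZFR.exists_min_realZeros_le
  refine ⟨c, hc, fun K _ _ h2 β₀ β₁ h00 h01 h10 h11 hne hz₀ hz₁ ↦ ?_⟩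
  obtain ⟨M, _, κ, hM, hκ, -, hfac⟩ := exists_kroneckerChar (K := K) h2
  have := h M κ hκ β₀ β₁ (LFunction_eq_zero_of_realZero hκ hfac h00 h01 hz₀)
    (LFunction_eq_zero_of_realZero hκ hfac h10 h11 hz₁) hne
  have hM' : Real.log (M : ℝ) = Real.log ((NumberField.discr K).natAbs : ℝ) := by rw [hM]
  rwa [hM'] at this

/-- **Siegel's bound for the real zeros of `ζ_K`, `K` quadratic** (MV Corollary 11.15 for
`L(s, κ)`; ineffective): for every `ε > 0` there is `C > 0` such that for every quadratic field `K`
and every real zero `β < 1` of `ζ_K`, `C |d_K|^{−ε} ≤ 1 − β`.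
[cite: MontgomeryVaughan2007, Corollary 11.15] -/
theorem exists_one_sub_realZero_dedekindZetaCont_ge {ε : ℝ} (hε : 0 < ε) :
    ∃ C : ℝ, 0 < C ∧ ∀ (K : Type) [Field K] [NumberField K], finrank ℚ K = 2 → ∀ β : ℝ, β < 1 →
      dedekindZetaCont K β = 0 → C * ((NumberField.discr K).natAbs : ℝ) ^ (-ε) ≤ 1 - β := by
  obtain ⟨C, hC, h⟩ := Siegel.exists_one_sub_realZero_ge hε
  refine ⟨min C 1, by positivity, fun K _ _ h2 β hβ1 hz ↦ ?_⟩
  have hd1 : (1 : ℝ) ≤ ((NumberField.discr K).natAbs : ℝ) := by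
    have h := Int.one_le_abs (NumberField.discr_ne_zero K)
    rw [Int.abs_eq_natAbs] at h
    exact_mod_cast h
  have hpow : ((NumberField.discr K).natAbs : ℝ) ^ (-ε) ≤ 1 :=
    Real.rpow_le_one_of_one_le_of_nonpos hd1 (by linarith)
  rcases le_or_gt β 0 with hβ0 | hβ0
  · -- trivial: `1 − β ≥ 1`
    calc min C 1 * ((NumberField.discr K).natAbs : ℝ) ^ (-ε) ≤ 1 * 1 :=
          mul_le_mul (min_le_right _ _) hpow (by positivity) zero_le_one
      _ ≤ 1 - β := by linarith
  · obtain ⟨M, _, κ, hM, hκ, hsq, hfac⟩ := exists_kroneckerChar (K := K) h2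
    have hz' := LFunction_eq_zero_of_realZero hκ hfac hβ0 hβ1 hz
    have := h M κ hsq hκ β hz'
    have hM' : ((M : ℕ) : ℝ) = ((NumberField.discr K).natAbs : ℝ) := by rw [hM]
    rw [hM'] at this
    exact le_trans (mul_le_mul_of_nonneg_right (min_le_left _ _) (by positivity)) this

end Literature.NumberTheory.QuadraticFields.Quadratic

end
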